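import Summits.QuantumFields.BalabanUV.T4Continuum.Support.NE7MultiplierTermStepSharp
import Summits.QuantumFields.BalabanUV.T4Continuum.Support.NE3QuadRemainderTower
import HarnessLib

/-!
# NE7MultiplierTermLevelMasses — (G3) REDUCED TO THE LEVEL MASSES OF THE LINEARISED AVERAGES, WITH GEOMETRIC WEIGHTS `L^{−3(m−i)}`:
# `|Dm(0)[D²𝒢_{m,W}(0)[ψ,ψ]]| ≤ 2·curl1C·ε·K_C·Σ_{i=0}^{m} K_maj·(L∕L⁴)^{m−i}·Σ_{b ∈ [0, N·L^{m−i+1})⁴} ‖(dirIter L i W ψ̃)_b‖²` for EVERY base `W` of row NE3-R2's multi-level class whose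
# `(m+1)`-fold average is the datum `V₀` — in particular `W = U♯`, `m = j`: the multiplier term of the bordered Hessian ✓ p828683 is `ε` times a geometrically weighted sum of the `ℓ²`
# masses of the linearised `i`-fold averages `ψ^{(i)} = D(cavgIter i)(U♯)[X̃]` of the lift (`d = 4`, every `U(n)`, `L ≥ 2`, every level, every volume; ROAD-G116 §6 (G3))

Cell `pub-balaban`, rung (B)+1 sub-cell t4, lineage `b2b-balaban-t4-ne7b-p1` (row NE7b OWNER + CRUX PROVER; junction service for row NE7, ruling R-OWNER-149-1 (2)), generation 161.
Index `t4/b2b-balaban-t4-ne7b-p1/g161/INDEX.md`; memo `g161/records/SCOPING-G3.md`.  The induction down the tower of bases `W, cavg W, cavg² W, …` of this seat's chain: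
(A) ✓ `NE7ConstraintSecondDerivativeRecursion` → (C) ✓ `NE7OneStepConstraintCurvature` → (E) ✓ `NE7MultiplierDensity` → (B)+(F) ✓ `NE7MultiplierTailLetter` → (G) ✓ `NE7MultiplierTermRecursion` →
(H) ✓ `NE7MultiplierTermStepSharp` (with the road's straight-tower `ℓ¹` contraction ✓ `sum_norm_QbarIter_le_Kmaj`).  `K_C = (4∕rho0 4 L²)·4·(2·nbRad 4 L+1)^4`,
`K_maj = exp((L⁴∕L)·4·16·5·8·L²·(1250(nbRad+L) + 32L + 2L)·2∕twoLevelSmall 4 L)` (constants BY NAME, not optimised).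
WHAT ([folklore]; 0 def, 0 sorry): `fderiv_coord_coe_eq_resDir_cpush` (`D coord_W(0)[ψ] = res (cpush W ψ̃)`), `dirIter_chartDir_fderiv_coord` (`dirIter i W̄ (Tψ)̃ = dirIter (i+1) W ψ̃`), and
**`multiplierTerm_le_levelMasses`** — the displayed bound, in the frame `∃ ε₀ > 0 ∀ 0 < ε ≤ ε₀ ∀ N ≥ 1 ∃ δ_V > 0 ∀ j ∀ V₀` (unitary, `N`-periodic, `δ_V`-small) `∀ U♯` minimiser, for every `m`, every base
`W` (unitary, `(tower L N (m+1))`-periodic, `SmallField W x`, `0 ≤ x`, `LevelSmall 4 L m x`, `cavgIter L (m+1) W = V₀`) and every `ψ ∈ skewSub (L·tower L N m)`, `ψ̃ = chartDir id ψ`.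
WHAT THE ROAD STILL SUPPLIES FOR (G3) ∕ (G): the level masses `Σ_b‖(dirIter i U♯ X̃)_b‖²` of its lifts `X` on its gauge slice (where ✓ `NE7BorderedHessianGaugeDegenerate` lets it choose the
representative modulo corner-trivial fine gauge directions) — e.g. `≤ C·(L^{−2}(1+Cε_i))^{i}·Σ‖X̃‖²` would give `|Dm(0)[D²𝒢(0)[X,X]]| ≤ ε·C(L)·L^{−2j}·Σ_b‖X̃_b‖² = ε·C(L)·L²·η²Σ‖X̃‖²`, j-UNIFORM.
HONEST FRAMING (page 1): composition of landed kernel theorems; nothing of Bałaban's asserted; NOT (G), NOT NE7 as a spine node, NOT NE3; row NE7b NOT PRINTED ∕ NOT PROVED; spine 0∕9;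
finite T⁴ rung (B)+1 — NOT infinite volume, NOT mass gap, NOT BetaPertH, NOT Clay.
-/

set_option autoImplicit false

open scoped BigOperators Matrix Matrix.Norms.L2Operator Topology
open NormedSpace Finset Set Filter Metric

namespace Summit.QuantumFields.BalabanUV.T4Continuum.NE7MultiplierTermLevelMasses

open Literature.MathematicalPhysics.QuantumFieldTheory.Balaban1983to89
open B7Prop1Explicit B7Prop2Explicit MatrixLog UnitaryModel
open T4AveragingDeficitWall (IsUnitaryCfg IsSkewDir SmallField dirL1 dirSq)
open T4AveragingDeficitWallBoundary (IsPeriodicCfg periodBox)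
open AveragingDeficitPeriodicCounting (IsPeriodicDir)
open AveragingDeficitTorusChart (TDir chart chartDir extDir resDir resDir_extDir chartDir_id_resDir)
open AveragingDeficitChartCalculus (cavg coord)
open AveragingDeficitFermat (small512_of_liftSmall)
open AveragingDeficitTwoLevelPrep (skewSub mem_skewSub twoLevelSmall smallness_of_twoLevelSmall)
open AveragingDeficitMultiLevelPrep (tower cavgIter levelQ LevelSmall cpush natCast_tower_succ fderiv_coord_resDir isPeriodicDir_cpush)
open AveragingDeficitMultiLevelBridge (tower_eq)
open MinimalActionSandwich (IsMinimiser minAct)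
open MinimalActionRate (sfClass SmallField.mono)
open NE3TangentCovariantTower (dirIter dirIter_succ)
open NE3QuadRemainderTower (cpush_skew)
open NE3HatInvCurlLetters (curl1C curl1C_nonneg)
open BlockAverageVaryHolo (nbRad)
open BlockAverageVaryDisc (rho0)
open NE7OneStepConstraintCurvature (ball_of_small512)
open NE7ConstraintSecondDerivativeRecursion (cavg_levelSmall)
open NE7MultiplierDensity (chartDir_id_eq_extDir)
open NE7MultiplierTermRecursion (multiplierTerm_base_le)
open NE7MultiplierTermStepSharp (multiplierTerm_step_le_sharp)

noncomputable section

variable {d : ℕ} {n : Type} [Fintype n] [DecidableEq n]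

/-! ## §1 Bookkeeping: the linearised one-step average of a torus direction, and the shift of the level masses -/

/-- **`D coord_W(0)[ψ] = res (cpush W ψ̃)`** (`ψ̃ = chartDir id ψ`; the loops of (42) at `W` in the ball of the logarithm). [folklore] -/
theorem fderiv_coord_coe_eq_resDir_cpush [Nonempty n] {L M : ℕ} [NeZero M] [NeZero (L * M)] {W : Site d → Fin d → (Matrix n n ℂ)ˣ}
    (hball : ∀ (q : Site d) (κ : Fin d) (r : Fin d → Fin L), ‖((Wcx L W q κ (boxVec L r) : (Matrix n n ℂ)ˣ) : Matrix n n ℂ) - 1‖ < 1) (ψ : TDir d n (L * M)) :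
    fderiv ℝ (coord (ContinuousLinearMap.id ℝ (Matrix n n ℂ)) L M W) 0 ψ = resDir M (cpush L W (chartDir (ContinuousLinearMap.id ℝ (Matrix n n ℂ)) (L * M) ψ)) := by
  have hψP : IsPeriodicDir (chartDir (ContinuousLinearMap.id ℝ (Matrix n n ℂ)) (L * M) ψ) ((L * M : ℕ) : ℤ) :=
    NE7OneStepConstraintCurvature.isPeriodicDir_chartDir (L * M) ψ
  have h := fderiv_coord_resDir (N := M) hball hψP
  rw [chartDir_id_eq_extDir, resDir_extDir] at h
  rw [chartDir_id_eq_extDir]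
  exact h

/-- **THE LEVEL MASSES SHIFT BY ONE along `T = D coord_W(0)`**: `dirIter L i (cavg L W) (Tψ)̃ = dirIter L (i+1) W ψ̃`. [folklore] -/
theorem dirIter_chartDir_fderiv_coord [Nonempty n] {L M : ℕ} [NeZero M] [NeZero (L * M)] {W : Site d → Fin d → (Matrix n n ℂ)ˣ}
    (hWP : IsPeriodicCfg W ((L : ℤ) * M))
    (hball : ∀ (q : Site d) (κ : Fin d) (r : Fin d → Fin L), ‖((Wcx L W q κ (boxVec L r) : (Matrix n n ℂ)ˣ) : Matrix n n ℂ) - 1‖ < 1) (ψ : TDir d n (L * M)) (i : ℕ) :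
    dirIter L i (cavg L W) (chartDir (ContinuousLinearMap.id ℝ (Matrix n n ℂ)) M (fderiv ℝ (coord (ContinuousLinearMap.id ℝ (Matrix n n ℂ)) L M W) 0 ψ))
      = dirIter L (i + 1) W (chartDir (ContinuousLinearMap.id ℝ (Matrix n n ℂ)) (L * M) ψ) := by
  have hψP : IsPeriodicDir (chartDir (ContinuousLinearMap.id ℝ (Matrix n n ℂ)) (L * M) ψ) ((L : ℤ) * M) := by
    have h := NE7OneStepConstraintCurvature.isPeriodicDir_chartDir (n := n) (L * M) ψ
    rwa [Nat.cast_mul] at h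
  rw [fderiv_coord_coe_eq_resDir_cpush hball ψ, chartDir_id_resDir M (isPeriodicDir_cpush L M hWP hψP), dirIter_succ]

/-! ## §2 The multiplier term against the level masses -/

/-- **(G3) REDUCED TO THE LEVEL MASSES** (see the module docstring; `d = 4`, every `U(n)`, `L ≥ 2`). [folklore] -/
theorem multiplierTerm_le_levelMasses [Nonempty n] {L : ℕ} [NeZero L] (hL : 2 ≤ L) :
    ∃ ε₀ : ℝ, 0 < ε₀ ∧ ∀ ε : ℝ, 0 < ε → ε ≤ ε₀ → ∀ (N : ℕ) [NeZero N], 1 ≤ N → ∃ δV : ℝ, 0 < δV ∧ ∀ j : ℕ,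
        ∀ V₀ ∈ {V : Site 4 → Fin 4 → (Matrix n n ℂ)ˣ | IsUnitaryCfg V ∧ IsPeriodicCfg V (N : ℤ) ∧ SmallField V δV},
        ∀ Us : Site 4 → Fin 4 → (Matrix n n ℂ)ˣ, IsMinimiser 4 (sfClass 4 L N ε) L N (j + 1) V₀ Us →
        ∀ (m : ℕ) (W : Site 4 → Fin 4 → (Matrix n n ℂ)ˣ) (x : ℝ), IsUnitaryCfg W → IsPeriodicCfg W ((tower L N (m + 1) : ℕ) : ℤ) → 0 ≤ x →
          LevelSmall 4 L m x → SmallField W x → cavgIter L (m + 1) W = V₀ →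
        ∀ ψ : ↥(skewSub 4 n (L * tower L N m)),
          |fderiv ℝ (fun y : ↥(skewSub 4 n N) => minAct 4 (sfClass 4 L N ε) L N (j + 1) (chart (ContinuousLinearMap.id ℝ (Matrix n n ℂ)) N V₀ (y : TDir 4 n N))) 0
              (fderiv ℝ (fderiv ℝ (fun Φ : TDir 4 n (L * tower L N m) =>
                levelQ L N m W (chart (ContinuousLinearMap.id ℝ (Matrix n n ℂ)) (L * tower L N m) W Φ))) 0
                (ψ : TDir 4 n (L * tower L N m)) (ψ : TDir 4 n (L * tower L N m)))|
            ≤ 2 * curl1C 4 L * ε * (4 / rho0 4 L ^ 2 * ((4 : ℕ) * (2 * nbRad 4 L + 1) ^ 4))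
                * ∑ i ∈ Finset.range (m + 1),
                    (Real.exp (((L : ℝ) ^ 4 / L) * (((4 : ℕ) : ℝ) * (16 * (((4 : ℕ) : ℝ) + 1) * (((4 : ℕ) : ℝ) + 4) * (L : ℝ) ^ 2)
                        * (1250 * ((nbRad 4 L : ℝ) + L) + 8 * ((((4 : ℕ) : ℝ)) * L) + 2 * L)) * (2 / twoLevelSmall 4 L))
                      * ((L : ℝ) / (L : ℝ) ^ 4) ^ (m - i))
                    * dirSq (dirIter L i W (chartDir (ContinuousLinearMap.id ℝ (Matrix n n ℂ)) (L * tower L N m) (ψ : TDir 4 n (L * tower L N m))))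
                        (periodBox (d := 4) (N * L ^ (m - i + 1))) := by
  obtain ⟨ε₁, hε₁, B⟩ := multiplierTerm_base_le (n := n) hL
  obtain ⟨ε₂, hε₂, S⟩ := multiplierTerm_step_le_sharp (n := n) hL
  have hL1 : 1 ≤ L := le_trans (by norm_num) hL
  refine ⟨min ε₁ ε₂, lt_min hε₁ hε₂, fun ε hε hεle N _ hN => ?_⟩
  obtain ⟨δ₁, hδ₁, B1⟩ := B ε hε (hεle.trans (min_le_left _ _)) N hN
  obtain ⟨δ₂, hδ₂, S1⟩ := S ε hε (hεle.trans (min_le_right _ _)) N hN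
  refine ⟨min δ₁ δ₂, lt_min hδ₁ hδ₂, fun j V₀ hV₀ Us hUs => ?_⟩
  obtain ⟨hV₀u, hV₀P, hV₀δ⟩ := hV₀
  have hV₀1 : V₀ ∈ {V : Site 4 → Fin 4 → (Matrix n n ℂ)ˣ | IsUnitaryCfg V ∧ IsPeriodicCfg V (N : ℤ) ∧ SmallField V δ₁} :=
    ⟨hV₀u, hV₀P, SmallField.mono hV₀δ (min_le_left _ _)⟩
  have hV₀2 : V₀ ∈ {V : Site 4 → Fin 4 → (Matrix n n ℂ)ˣ | IsUnitaryCfg V ∧ IsPeriodicCfg V (N : ℤ) ∧ SmallField V δ₂} :=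
    ⟨hV₀u, hV₀P, SmallField.mono hV₀δ (min_le_right _ _)⟩
  -- abbreviations for the constants
  set C : ℝ := 2 * curl1C 4 L * ε * (4 / rho0 4 L ^ 2 * ((4 : ℕ) * (2 * nbRad 4 L + 1) ^ 4)) with hC
  set K : ℝ := Real.exp (((L : ℝ) ^ 4 / L) * (((4 : ℕ) : ℝ) * (16 * (((4 : ℕ) : ℝ) + 1) * (((4 : ℕ) : ℝ) + 4) * (L : ℝ) ^ 2)
      * (1250 * ((nbRad 4 L : ℝ) + L) + 8 * ((((4 : ℕ) : ℝ)) * L) + 2 * L)) * (2 / twoLevelSmall 4 L)) with hK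
  set q : ℝ := (L : ℝ) / (L : ℝ) ^ 4 with hq
  have hC0 : 0 ≤ C := by have := curl1C_nonneg 4 L; rw [hC]; positivity
  have hK1 : 1 ≤ K := by
    rw [hK]
    refine Real.one_le_exp ?_
    have : 0 < twoLevelSmall 4 L := by unfold twoLevelSmall; positivity
    positivity
  -- induction down the tower of bases
  intro m
  induction m with
  | zero =>
      intro W x hWu hWP hx hs hWx _ ψ
      have h := B1 j V₀ hV₀1 Us hUs W x hWu hx hs hWx (ψ : TDir 4 n (L * tower L N 0))
      refine h.trans ?_
      have e1 : N * L ^ (0 - 0 + 1) = L * N := by rw [Nat.sub_zero, zero_add, pow_one, Nat.mul_comm]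
      rw [Finset.sum_range_one, e1, Nat.sub_zero, pow_zero, mul_one, NE3TangentCovariantTower.dirIter_zero]
      have hDD : dirSq (chartDir (ContinuousLinearMap.id ℝ (Matrix n n ℂ)) (L * tower L N 0) (ψ : TDir 4 n (L * tower L N 0))) (periodBox (d := 4) (L * N))
          = dirSq (chartDir (ContinuousLinearMap.id ℝ (Matrix n n ℂ)) (L * N) (ψ : TDir 4 n (L * tower L N 0))) (periodBox (d := 4) (L * N)) := rfl
      rw [hDD]
      have hD : 0 ≤ dirSq (chartDir (ContinuousLinearMap.id ℝ (Matrix n n ℂ)) (L * N) (ψ : TDir 4 n (L * tower L N 0))) (periodBox (d := 4) (L * N)) := by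
        unfold dirSq; exact Finset.sum_nonneg fun _ _ => Finset.sum_nonneg fun _ _ => sq_nonneg _
      have hL : 2 * curl1C 4 L * ε * (4 / rho0 4 L ^ 2 * ((4 : ℕ) * (2 * nbRad 4 L + 1) ^ 4)
            * dirSq (chartDir (ContinuousLinearMap.id ℝ (Matrix n n ℂ)) (L * N) (ψ : TDir 4 n (L * tower L N 0))) (periodBox (d := 4) (L * N)))
          = C * dirSq (chartDir (ContinuousLinearMap.id ℝ (Matrix n n ℂ)) (L * N) (ψ : TDir 4 n (L * tower L N 0))) (periodBox (d := 4) (L * N)) := by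
        rw [hC]; ring
      rw [hL]
      exact mul_le_mul_of_nonneg_left (le_mul_of_one_le_left hD hK1) hC0
  | succ m ih =>
      intro W x hWu hWP hx hs hWx htop ψ
      -- the step in final currency
      have hstep := S1 j V₀ hV₀2 Us hUs m W x hWu hWP hx hs hWx htop ψ
      -- the base one level up, and the pushed direction as a skew torus field
      have hWP' : IsPeriodicCfg W ((L : ℤ) * (tower L N (m + 1) : ℕ)) := by rw [← natCast_tower_succ]; exact hWP
      obtain ⟨x', hx', hs', hWu', hWbP, hWx', hball⟩ := cavg_levelSmall (M' := N) hL1 m hWu hWP' hx hs hWx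
      have hWbP' : IsPeriodicCfg (cavg L W) ((tower L N (m + 1) : ℕ) : ℤ) := by rw [natCast_tower_succ]; exact hWbP
      have htop' : cavgIter L (m + 1) (cavg L W) = V₀ := htop
      obtain ⟨hlift, -, -, -⟩ := smallness_of_twoLevelSmall (d := 4) hL1 hx hs.1
      have h512 := small512_of_liftSmall hL1 hx hlift
      set ψt : Site 4 → Fin 4 → Matrix n n ℂ := chartDir (ContinuousLinearMap.id ℝ (Matrix n n ℂ)) (L * tower L N (m + 1)) (ψ : TDir 4 n (L * tower L N (m + 1))) with hψt
      have hψts : IsSkewDir ψt := fun z κ => (mem_skewSub.mp ψ.2) _ _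
      have hT := fderiv_coord_coe_eq_resDir_cpush (M := L * tower L N m) hball (ψ : TDir 4 n (L * tower L N (m + 1)))
      have hTmem : fderiv ℝ (coord (ContinuousLinearMap.id ℝ (Matrix n n ℂ)) L (L * tower L N m) W) 0 (ψ : TDir 4 n (L * tower L N (m + 1)))
          ∈ skewSub 4 n (L * tower L N m) := by
        refine mem_skewSub.mpr fun r κ => ?_
        have e := congrFun (congrFun hT r) κ
        rw [e]
        exact cpush_skew hL1 hWu hx h512 hWx hψts _ _
      have hIH := ih (cavg L W) x' hWu' hWbP' hx' hs' hWx' htop'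
        ⟨fderiv ℝ (coord (ContinuousLinearMap.id ℝ (Matrix n n ℂ)) L (L * tower L N m) W) 0 (ψ : TDir 4 n (L * tower L N (m + 1))), hTmem⟩
      -- the level masses shift by one
      have hWPm : IsPeriodicCfg W ((L : ℤ) * (L * tower L N m : ℕ)) := hWP'
      have hshift : ∀ i : ℕ, dirIter L i (cavg L W) (chartDir (ContinuousLinearMap.id ℝ (Matrix n n ℂ)) (L * tower L N m)
            (fderiv ℝ (coord (ContinuousLinearMap.id ℝ (Matrix n n ℂ)) L (L * tower L N m) W) 0 (ψ : TDir 4 n (L * tower L N (m + 1)))))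
          = dirIter L (i + 1) W ψt := fun i => dirIter_chartDir_fderiv_coord (M := L * tower L N m) hWPm hball _ i
      simp only [hshift] at hIH
      refine hstep.trans ?_
      -- reorganise the sum: `Σ_{i<m+2} f i = Σ_{i<m+1} f (i+1) + f 0`
      have hsum : C * ∑ i ∈ Finset.range (m + 1 + 1), K * q ^ (m + 1 - i) * dirSq (dirIter L i W ψt) (periodBox (d := 4) (N * L ^ (m + 1 - i + 1)))
          = C * ∑ i ∈ Finset.range (m + 1), K * q ^ (m - i) * dirSq (dirIter L (i + 1) W ψt) (periodBox (d := 4) (N * L ^ (m - i + 1)))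
            + C * (K * q ^ (m + 1) * dirSq (dirIter L 0 W ψt) (periodBox (d := 4) (N * L ^ (m + 1 + 1)))) := by
        rw [Finset.sum_range_succ' _ (m + 1), mul_add]
        congr 1
        · congr 1
          refine Finset.sum_congr rfl fun i _ => ?_
          rw [Nat.succ_sub_succ]
      have hper : (L * tower L N (m + 1) : ℕ) = N * L ^ (m + 1 + 1) := by rw [tower_eq]; ring
      have hnew : 2 * curl1C 4 L * ε * ((K * q ^ (m + 1)) * ((4 / rho0 4 L ^ 2 * ((4 : ℕ) * (2 * nbRad 4 L + 1) ^ 4))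
              * dirSq ψt (periodBox (d := 4) (L * tower L N (m + 1)))))
          = C * (K * q ^ (m + 1) * dirSq (dirIter L 0 W ψt) (periodBox (d := 4) (N * L ^ (m + 1 + 1)))) := by
        rw [NE3TangentCovariantTower.dirIter_zero, hper, hC]; ring
      rw [hsum]
      linarith [hIH, hnew.le, hnew.symm.le]

end

end Summit.QuantumFields.BalabanUV.T4Continuum.NE7MultiplierTermLevelMasses
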